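import Summits.Ventures.Crystal3D.Theorems.StickyWulffConstantCoaxialWallLawTailResidueDefsL
import Summits.Ventures.Crystal3D.Theorems.StickyWulffConstantCoaxialWallLawReadingDirectionsContacts
import HarnessLib

/-!
# The CANONICAL LENS TYPE of a window is well formed and realisable (validation of `…TailResidueDefsL`; T4 bookkeeping half)
# (crux `CoaxialWallLaw`, stmt-Ventures-19481; cf-p1 DECISION (cxi); census-free)

HONEST FRAMING. Venture `Summits/Ventures/Crystal3D` (cell `crystal3d-full`); helper `--supports` the crux `CoaxialWallLaw`
(stmt-Ventures-19481, `route-Ventures-StickyWulffConstant`), registered line 'CoaxialWallLawCertificates' (planner cf-p1).  Census-free;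
F-C1 not moved.  For a `1`-separated configuration `X` IN MODULE COORDINATES (payer at `0 = modSite 0 ∈ X` with `≤ 11` contacts) define
its canonical position-based lens type and prove the two STRUCTURAL conjuncts of `LensSoundness`'s witness:
* `occOf X` (occupied sites of the window), `apexOf X` (occupied apex positions), `exactOf X`, `refPoint`, `hostRefsOf X`, `hostsOf X x`
  (the exact balls touching `x`), `dustOf X` (non-exact balls with an exact contact within `2` of the payer), `looseOf X`, **`typeOf X`**;
* `modSite_zero`, `modSite_injective`, `mem_siteBall_of_dsq12`, `mem_coaxialModule_iff` (the module is the range of `modSite`),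
  `typeOf_realise` (`= exactOf X ⊆ X`);
* **`typeOf_wellFormed`** and **`typeOf_realisable`** (the joint loose witnesses are the dust balls themselves: off the module — else they
  would be occupied sites of the window —, at no apex position — else occupied apex positions —, at distance `1` from exactly their hosts,
  pairwise `≥ 1`).
What remains for `LensSoundness` is the INEQUALITY `localSummandA ≤ (typeOf X).row L₀` (hD / frame side + `…DustDecorationLens` with
`dustDeg = looseAt ∘ typeOf`) and the placement step (module coordinates from the first reader).
WHAT THIS IS NOT: not `LensSoundness`; F-C1 not moved.
-/

noncomputable section

-- the window Finsets (`siteBall`, `apexBall`) are large closed terms; unification around them needs a deeper recursion budget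
set_option maxRecDepth 65536

namespace Summit.Ventures.Crystal3D.Theorems

namespace TailResidue

open Summit.Ventures.Crystal3D Finset
open Literature.MathematicalPhysics.StatisticalMechanics (triangularVec₁ triangularVec₂ barlowOffset layerNormal)
open scoped InnerProductSpace

/-! ### Module-site facts -/

/-- The payer site is the origin. -/
theorem modSite_zero : modSite ((0, 0, 0) : ℤ × ℤ × ℤ) = 0 := by
  simp [modSite]

/-- `dsq12 0 d = 0` only for `d = 0`. -/
theorem eq_zero_of_dsq12_eq_zero {d : ℤ × ℤ × ℤ} (h : dsq12 (0, 0, 0) d = 0) : d = (0, 0, 0) := by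
  obtain ⟨i, n, k⟩ := d
  simp only [dsq12, sub_zero] at h
  have hk : k = 0 := by nlinarith [sq_nonneg (2 * i + n), sq_nonneg n, sq_nonneg k]
  have hn : n = 0 := by nlinarith [sq_nonneg (2 * i + n), sq_nonneg n, sq_nonneg k]
  subst hk hn
  have hi : i = 0 := by nlinarith [sq_nonneg i]
  subst hi
  rfl

/-- `modSite` is injective. -/
theorem modSite_injective : Function.Injective modSite := by
  intro s t h
  have hd : dist (modSite s) (modSite t) = 0 := by rw [h, dist_self]
  have hsq := dist_modSite_sq s t
  rw [hd] at hsq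
  have h0 : dsq12 s t = 0 := by
    have : (dsq12 s t : ℝ) = 0 := by linarith
    exact_mod_cast this
  have h0' : dsq12 (0, 0, 0) (t.1 - s.1, t.2.1 - s.2.1, t.2.2 - s.2.2) = 0 := by
    have e : dsq12 (0, 0, 0) (t.1 - s.1, t.2.1 - s.2.1, t.2.2 - s.2.2) = dsq12 s t := by simp only [dsq12]; ring
    rw [e, h0]
  have := eq_zero_of_dsq12_eq_zero h0'
  simp only [Prod.mk.injEq] at this
  obtain ⟨h1, h2, h3⟩ := this
  ext <;> omega

/-- Sites within `3` of the payer are in `siteBall`. -/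
theorem mem_siteBall_of_dsq12 {d : ℤ × ℤ × ℤ} (h : dsq12 (0, 0, 0) d ≤ 108) : d ∈ siteBall := by
  obtain ⟨i, n, k⟩ := d
  have h' := h
  simp only [dsq12, sub_zero] at h'
  rw [siteBall, Finset.mem_filter, Finset.mem_product, Finset.mem_product, Finset.mem_Icc, Finset.mem_Icc, Finset.mem_Icc]
  refine ⟨⟨⟨?_, ?_⟩, ⟨?_, ?_⟩, ⟨?_, ?_⟩⟩, h⟩ <;>
    nlinarith [sq_nonneg (2 * i + n), sq_nonneg n, sq_nonneg k, sq_nonneg (i + n), sq_nonneg i]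

/-- **The coaxial module is the range of `modSite`.** -/
theorem mem_coaxialModule_iff {x : EuclideanSpace ℝ (Fin 3)} :
    x ∈ coaxialModule 1 (Real.sqrt (2 / 3)) ↔ ∃ s : ℤ × ℤ × ℤ, x = modSite s := by
  constructor
  · rintro ⟨i, j, n, k, rfl⟩
    refine ⟨(i - j, 3 * j + n, k), ?_⟩
    have ht : triangularVec₂ (1 : ℝ) = (3 : ℝ) • barlowOffset 1 - triangularVec₁ 1 := by
      ext t; fin_cases t <;> simp [triangularVec₂, barlowOffset, triangularVec₁] <;> ring
    rw [ht, modSite]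
    push_cast
    module
  · rintro ⟨s, rfl⟩
    exact modSite_mem_coaxialModule s

/-- A module vector of length `≤ 3` has `dsq12 ≤ 108`. -/
theorem dsq12_le_of_norm_le_three {d : ℤ × ℤ × ℤ} (h : ‖modSite d‖ ≤ 3) : dsq12 (0, 0, 0) d ≤ 108 := by
  have hsq := norm_modSite_sq d
  have h9 : ‖modSite d‖ ^ 2 ≤ 9 := by nlinarith [norm_nonneg (modSite d)]
  have : (dsq12 (0, 0, 0) d : ℝ) ≤ 108 := by linarith
  exact_mod_cast this

/-! ### The canonical type -/

variable (X : Finset (EuclideanSpace ℝ (Fin 3)))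

open scoped Classical in
/-- Occupied sites of the window. -/
def occOf : Finset (ℤ × ℤ × ℤ) := siteBall.filter fun s => modSite s ∈ X

open scoped Classical in
/-- Occupied apex positions of the window. -/
def apexOf : Finset (ℤ × ℤ × ℤ) := apexBall.filter fun F => fineVec F ∈ X

/-- The exact balls of the window. -/
def exactOf : Finset (EuclideanSpace ℝ (Fin 3)) := (occOf X).image modSite ∪ (apexOf X).image fineVec

/-- The point of a site/apex host reference (junction references are not used by the canonical type). -/
def refPoint : HostRefL → EuclideanSpace ℝ (Fin 3)
  | .site s => modSite s
  | .apex F => fineVec F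
  | .junc s => modSite s

/-- The candidate host references: occupied sites and occupied apex positions. -/
def hostRefsOf : Finset HostRefL := (occOf X).image HostRefL.site ∪ (apexOf X).image HostRefL.apex

open scoped Classical in
/-- The hosts of a point: the exact balls touching it. -/
def hostsOf (x : EuclideanSpace ℝ (Fin 3)) : Finset HostRefL := (hostRefsOf X).filter fun h => dist x (refPoint h) = 1

open scoped Classical in
/-- The dust balls that matter: non-exact balls with a host within `2` of the payer. -/
def dustOf : Finset (EuclideanSpace ℝ (Fin 3)) := X.filter fun x => x ∉ exactOf X ∧ ∃ h ∈ hostsOf X x, h.Near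

/-- The loose fillers: the host sets of the dust balls. -/
def looseOf : List (Finset HostRefL) := (dustOf X).toList.map (hostsOf X)

/-- **THE CANONICAL LENS TYPE of the window** (no junction). -/
def typeOf : LensType := ⟨occOf X, apexOf X, looseOf X, none⟩

/-! ### Basic identities -/

/-- Host points of the canonical type are reference points. -/
theorem typeOf_hostPoint (h : HostRefL) : (typeOf X).hostPoint h = refPoint h := by
  cases h <;> rfl

/-- The exact balls of the canonical type. -/
theorem typeOf_realise : (typeOf X).realise = exactOf X := by
  simp [LensType.realise, typeOf, exactOf]

/-- Exact balls are balls. -/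
theorem exactOf_subset : exactOf X ⊆ X := by
  intro p hp
  rcases Finset.mem_union.1 hp with h | h
  · obtain ⟨s, hs, rfl⟩ := Finset.mem_image.1 h
    exact (Finset.mem_filter.1 hs).2
  · obtain ⟨F, hF, rfl⟩ := Finset.mem_image.1 h
    exact (Finset.mem_filter.1 hF).2

/-- Reference points of candidate hosts are exact balls. -/
theorem refPoint_mem_exactOf {h : HostRefL} (hh : h ∈ hostRefsOf X) : refPoint h ∈ exactOf X := by
  rcases Finset.mem_union.1 hh with h1 | h1
  · obtain ⟨s, hs, rfl⟩ := Finset.mem_image.1 h1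
    exact Finset.mem_union_left _ (Finset.mem_image_of_mem _ hs)
  · obtain ⟨F, hF, rfl⟩ := Finset.mem_image.1 h1
    exact Finset.mem_union_right _ (Finset.mem_image_of_mem _ hF)

/-- Every exact ball is the reference point of a candidate host. -/
theorem exists_ref_of_mem_exactOf {p : EuclideanSpace ℝ (Fin 3)} (hp : p ∈ exactOf X) : ∃ h ∈ hostRefsOf X, refPoint h = p := by
  rcases Finset.mem_union.1 hp with h | h
  · obtain ⟨s, hs, rfl⟩ := Finset.mem_image.1 h
    exact ⟨.site s, Finset.mem_union_left _ (Finset.mem_image_of_mem _ hs), rfl⟩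
  · obtain ⟨F, hF, rfl⟩ := Finset.mem_image.1 h
    exact ⟨.apex F, Finset.mem_union_right _ (Finset.mem_image_of_mem _ hF), rfl⟩

/-- A NEAR host is within `2` of the payer. -/
theorem norm_refPoint_le_two {h : HostRefL} (hh : h ∈ hostRefsOf X) (hn : h.Near) : ‖refPoint h‖ ≤ 2 := by
  rcases Finset.mem_union.1 hh with h1 | h1
  · obtain ⟨s, -, rfl⟩ := Finset.mem_image.1 h1
    simp only [HostRefL.Near] at hn
    have hsq := norm_modSite_sq s
    have h4 : ‖modSite s‖ ^ 2 ≤ 4 := by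
      rw [hsq]; have : (dsq12 (0, 0, 0) s : ℝ) ≤ 48 := by exact_mod_cast hn
      linarith
    show ‖modSite s‖ ≤ 2
    nlinarith [norm_nonneg (modSite s)]
  · obtain ⟨F, -, rfl⟩ := Finset.mem_image.1 h1
    simp only [HostRefL.Near] at hn
    have hsq := norm_fineVec_sq F
    have h4 : ‖fineVec F‖ ^ 2 ≤ 4 := by
      rw [hsq]; have : (dotI F F : ℝ) ≤ 648 := by exact_mod_cast hn
      linarith
    show ‖fineVec F‖ ≤ 2
    nlinarith [norm_nonneg (fineVec F)]

/-! ### Well-formedness -/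

variable {X}
variable (hX : ∀ p ∈ X, ∀ q ∈ X, p ≠ q → 1 ≤ dist p q) (h0 : (0 : EuclideanSpace ℝ (Fin 3)) ∈ X)

open scoped Classical in
include hX h0 in
/-- **The canonical lens type is well formed.** -/
theorem typeOf_wellFormed (hdeg : (X.filter fun q => dist (0 : EuclideanSpace ℝ (Fin 3)) q = 1).card ≤ 11) :
    (typeOf X).WellFormed := by
  refine ⟨Finset.filter_subset _ _, ?_, ?_, ?_, Finset.filter_subset _ _, ?_, trivial⟩
  · -- the payer site is occupied
    refine Finset.mem_filter.2 ⟨mem_siteBall_of_dsq12 (by simp [dsq12]), ?_⟩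
    rw [modSite_zero]; exact h0
  · -- `1`-separation on the module
    intro s hs t ht hne
    have hs' := (Finset.mem_filter.1 hs).2
    have ht' := (Finset.mem_filter.1 ht).2
    have hd : 1 ≤ dist (modSite s) (modSite t) := hX _ hs' _ ht' (fun h => hne (modSite_injective h))
    have hsq := dist_modSite_sq s t
    have : (12 : ℝ) ≤ dsq12 s t := by nlinarith [dist_nonneg (x := modSite s) (y := modSite t)]
    exact_mod_cast this
  · -- at most `11` menu contacts
    refine le_trans (Finset.card_le_card_of_injOn modSite (fun s hs => ?_) fun s _ t _ h => modSite_injective h) hdeg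
    obtain ⟨hs, h12⟩ := Finset.mem_filter.1 hs
    refine Finset.mem_coe.2 (Finset.mem_filter.2 ⟨(Finset.mem_filter.1 hs).2, ?_⟩)
    have hsq := dist_modSite_sq (0, 0, 0) s
    rw [modSite_zero, h12] at hsq
    have h1 : dist (0 : EuclideanSpace ℝ (Fin 3)) (modSite s) ^ 2 = 1 := by rw [hsq]; norm_num
    nlinarith [dist_nonneg (x := (0 : EuclideanSpace ℝ (Fin 3))) (y := modSite s)]
  · -- loose host sets
    intro H hH
    obtain ⟨x, hx, rfl⟩ := List.mem_map.1 hH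
    rw [Finset.mem_toList] at hx
    obtain ⟨-, -, h, hh, hn⟩ := Finset.mem_filter.1 hx
    refine ⟨Finset.card_pos.2 ⟨h, hh⟩, fun h' hh' => ?_, ⟨h, hh, hn⟩⟩
    have hmem := (Finset.mem_filter.1 hh').1
    rcases Finset.mem_union.1 hmem with h1 | h1
    · obtain ⟨s, hs, rfl⟩ := Finset.mem_image.1 h1
      exact hs
    · obtain ⟨F, hF, rfl⟩ := Finset.mem_image.1 h1
      exact hF

/-! ### Realisability -/

open scoped Classical in
include hX in
/-- A dust ball is within `3` of the payer. -/
theorem norm_le_three_of_mem_dustOf {x : EuclideanSpace ℝ (Fin 3)} (hx : x ∈ dustOf X) : ‖x‖ ≤ 3 := by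
  have _ := hX
  obtain ⟨-, -, h, hh, hn⟩ := Finset.mem_filter.1 hx
  obtain ⟨hh', hd⟩ := Finset.mem_filter.1 hh
  have h2 := norm_refPoint_le_two X hh' hn
  calc ‖x‖ = ‖(x - refPoint h) + refPoint h‖ := by rw [sub_add_cancel]
    _ ≤ ‖x - refPoint h‖ + ‖refPoint h‖ := norm_add_le _ _
    _ ≤ 1 + 2 := by rw [← dist_eq_norm, hd]; linarith
    _ = 3 := by norm_num

open scoped Classical in
include hX in
/-- **A dust ball is off the module** (else it would be an occupied site of the window). -/
theorem not_mem_coaxialModule_of_mem_dustOf {x : EuclideanSpace ℝ (Fin 3)} (hx : x ∈ dustOf X) :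
    x ∉ coaxialModule 1 (Real.sqrt (2 / 3)) := by
  intro hmod
  obtain ⟨s, rfl⟩ := mem_coaxialModule_iff.1 hmod
  obtain ⟨hxX, hne, -⟩ := Finset.mem_filter.1 hx
  apply hne
  have hs : s ∈ siteBall := mem_siteBall_of_dsq12 (dsq12_le_of_norm_le_three (norm_le_three_of_mem_dustOf hX hx))
  exact Finset.mem_union_left _ (Finset.mem_image_of_mem _ (Finset.mem_filter.2 ⟨hs, hxX⟩))

open scoped Classical in
/-- **A dust ball is at no apex position of the window** (else it would be an occupied apex position). -/
theorem ne_fineVec_of_mem_dustOf {x : EuclideanSpace ℝ (Fin 3)} (hx : x ∈ dustOf X) {F : ℤ × ℤ × ℤ} (hF : F ∈ apexBall) :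
    x ≠ fineVec F := by
  rintro rfl
  obtain ⟨hxX, hne, -⟩ := Finset.mem_filter.1 hx
  exact hne (Finset.mem_union_right _ (Finset.mem_image_of_mem _ (Finset.mem_filter.2 ⟨hF, hxX⟩)))

open scoped Classical in
include hX in
/-- **The canonical lens type is realisable**: the dust balls themselves are the joint witnesses. -/
theorem typeOf_realisable : (typeOf X).Realisable := by
  refine ⟨?_, ?_⟩
  · intro p hp q hq hne
    rw [typeOf_realise] at hp hq
    exact hX p (exactOf_subset X hp) q (exactOf_subset X hq) hne
  · set L := (dustOf X).toList with hL
    refine ⟨fun i => L.getD i 0, ?_, ?_⟩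
    · intro i H hH
      dsimp only
      -- `loose[i]? = some H` means `H = hostsOf X x` for the `i`-th dust ball `x`
      have hmap : (typeOf X).loose = L.map (hostsOf X) := rfl
      rw [hmap, List.getElem?_map] at hH
      cases hLi : L[i]? with
      | none => rw [hLi] at hH; simp at hH
      | some x =>
        rw [hLi] at hH
        simp only [Option.map_some, Option.some.injEq] at hH
        subst hH
        have hxi : L.getD i 0 = x := by rw [List.getD_eq_getElem?_getD, hLi, Option.getD_some]
        rw [hxi]
        have hx : x ∈ dustOf X := by rw [← Finset.mem_toList, ← hL]; exact List.mem_of_getElem? hLi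
        refine ⟨not_mem_coaxialModule_of_mem_dustOf hX hx, fun F hF => ne_fineVec_of_mem_dustOf hx hF, fun h hh => ?_, fun p hp hpn => ?_⟩
        · rw [typeOf_hostPoint]; exact (Finset.mem_filter.1 hh).2
        · rw [typeOf_realise] at hp
          obtain ⟨hxX, hxne, -⟩ := Finset.mem_filter.1 hx
          have hpx : p ≠ x := fun h => hxne (h ▸ hp)
          have h1 : 1 ≤ dist x p := by rw [dist_comm]; exact hX p (exactOf_subset X hp) x hxX hpx
          refine lt_of_le_of_ne h1 fun heq => hpn ?_
          obtain ⟨h, hh, rfl⟩ := exists_ref_of_mem_exactOf X hp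
          refine Finset.mem_image.2 ⟨h, Finset.mem_filter.2 ⟨hh, heq.symm⟩, ?_⟩
          rw [typeOf_hostPoint]
    · intro i j hij hi hj
      dsimp only
      have hlen : (typeOf X).loose.length = L.length := by simp [typeOf, looseOf, hL]
      rw [hlen] at hi hj
      have hnd : L.Nodup := Finset.nodup_toList _
      have hgi : L.getD i 0 = L[i] := by rw [List.getD_eq_getElem?_getD, List.getElem?_eq_getElem hi, Option.getD_some]
      have hgj : L.getD j 0 = L[j] := by rw [List.getD_eq_getElem?_getD, List.getElem?_eq_getElem hj, Option.getD_some]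
      rw [hgi, hgj]
      have hne : L[i] ≠ L[j] := fun h => hij ((hnd.getElem_inj_iff).1 h)
      have hiD : L[i] ∈ dustOf X := by rw [← Finset.mem_toList, ← hL]; exact List.getElem_mem hi
      have hjD : L[j] ∈ dustOf X := by rw [← Finset.mem_toList, ← hL]; exact List.getElem_mem hj
      have hiX : L[i] ∈ X := (Finset.mem_filter.1 hiD).1
      have hjX : L[j] ∈ X := (Finset.mem_filter.1 hjD).1
      exact hX _ hiX _ hjX hne

end TailResidue

end Summit.Ventures.Crystal3D.Theorems

end
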